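import Mathlib.Analysis.Distribution.SchwartzSpace.Basic
import Mathlib.Geometry.Manifold.PartitionOfUnity
import Mathlib.MeasureTheory.Measure.Regular
import Mathlib.MeasureTheory.Integral.Bochner.Set
import Summits.QuantumFields.YangMills.Theorems.LangevinControlUVOSLegsAtWeakCouplingCDefs
import HarnessLib

/-!
# Null-set closure for a locally vanishing functional with bounded density (helper of `stub_locality`)

Helper file for stub `stub_locality` of crux `OSLegsAtWeakCouplingC` (stmt-QuantumFields-16207, line `Sketch`),
step T6 ("closure") of the lead's architecture.  The defect functional `G = S₁ ∘ R − S₁` of a one-field family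
is a continuous linear functional on the Schwartz `n`-point functions `𝓢((Fin n → ℝ⁴), ℂ)` which

* vanishes LOCALLY near every configuration outside a closed Lebesgue-null exceptional set `N` (a finite union of
  hyperplanes; only `IsClosed N` and `volume N = 0` are used), and
* has a bounded density on compactly supported test functions supported at pairwise distance `≥ δ`
  (`‖G F‖ ≤ B ∫ ‖F‖`, the landed `stub_density`).

`eq_zero_of_null_exceptional` concludes `G F = 0` for every compactly supported `F` with
`tsupport F ⊆ Separated n δ`.  Proof (standard distribution theory):

1. `exists_contDiff_one_nhds_of_isCompact_subset` — a smooth compactly supported cutoff `χ : X → [0,1]` equal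
   to `1` on a neighbourhood of a compact set `C` and supported in a given open `O ⊇ C` (smooth Urysohn lemma of
   `Mathlib.Geometry.Manifold.PartitionOfUnity` on the model space `𝓘(ℝ, X)`, applied to
   `C ⊆ cthickening r C ⊆ O`);
2. `exists_isOpen_forall_eq_zero_of_locally` — the SHEAF STEP: a functional vanishing on test functions supported
   near each point of a compact `K` vanishes on test functions supported in some open `W ⊇ K`
   (`IsCompact.induction_on`; the union step splits `H = χH + (1 − χ)H` with the cutoff of 1.);
3. the closure: for `η > 0` choose an open `O ⊇ N ∩ tsupport F` of volume `< η` (outer regularity), a cutoff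
   `χ` near the compact null set `N ∩ tsupport F` inside `O`, and split `F = χF + (1 − χ)F`.  The second piece is
   supported in `tsupport F` minus a neighbourhood of `N`, so the sheaf step and local vanishing kill it; the first
   is supported in `Separated n δ ∩ O`, so `‖G (χF)‖ ≤ B ∫ ‖χF‖ ≤ B · sup ‖F‖ · η`.  Letting `η → 0` gives
   `G F = 0`.

Multiplication of a Schwartz function by the smooth compactly supported `χ` is Mathlib's
`SchwartzMap.smulLeftCLM` (a compactly supported smooth function has temperate growth).  No new definitions.

Refs: Hörmander, *The Analysis of Linear Partial Differential Operators I*, Thm 2.2.1 (sheaf property of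
distributions) and §1.4 (cutoffs); GlimmJaffe1987 §6.1.
-/

set_option autoImplicit false

noncomputable section

open scoped SchwartzMap ContDiff Manifold
open MeasureTheory Filter Topology Set

namespace Summit.QuantumFields.YangMills.Cruxes.OSLegsAtWeakCouplingC.Sketch

section General

variable {X : Type*} [NormedAddCommGroup X] [NormedSpace ℝ X] [FiniteDimensional ℝ X]

/-- **Smooth cutoff near a compact set.**  In a finite-dimensional real normed space, for a compact `C` inside
an open `O` there is a `C^∞` function `χ` with compact support, `tsupport χ ⊆ O`, values in `[0, 1]`, and `χ = 1`
on an open neighbourhood of `C`.  (Smooth Urysohn lemma, e.g. Hörmander, *ALPDO I*, Thm 1.4.1; here from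
Mathlib's `exists_contMDiffMap_one_nhds_of_subset_interior` on the model manifold `𝓘(ℝ, X)` with
`C ⊆ cthickening r C ⊆ O`.) -/
theorem exists_contDiff_one_nhds_of_isCompact_subset {C O : Set X} (hC : IsCompact C) (hO : IsOpen O)
    (hCO : C ⊆ O) :
    ∃ χ : X → ℝ, ContDiff ℝ ∞ χ ∧ HasCompactSupport χ ∧ tsupport χ ⊆ O ∧
      (∀ x, χ x ∈ Icc (0 : ℝ) 1) ∧ ∃ U : Set X, IsOpen U ∧ C ⊆ U ∧ ∀ x ∈ U, χ x = 1 := by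
  obtain ⟨r, hr, hrO⟩ := hC.exists_cthickening_subset_open hO hCO
  have hCint : C ⊆ interior (Metric.cthickening r C) :=
    (Metric.self_subset_thickening hr C).trans (Metric.thickening_subset_interior_cthickening r C)
  obtain ⟨f, hf1, hf0, hf01⟩ :=
    exists_contMDiffMap_one_nhds_of_subset_interior 𝓘(ℝ, X) (n := (⊤ : ℕ∞)) hC.isClosed hCint
  have hsupp : Function.support (f : X → ℝ) ⊆ Metric.cthickening r C := by
    intro x hx
    by_contra hx'
    exact hx (hf0 x hx')
  have htsupp : tsupport (f : X → ℝ) ⊆ Metric.cthickening r C :=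
    closure_minimal hsupp Metric.isClosed_cthickening
  obtain ⟨U, hU, hCU, hU1⟩ := mem_nhdsSet_iff_exists.mp hf1
  refine ⟨f, ?_, ?_, htsupp.trans hrO, hf01, U, hU, hCU, fun x hx => hU1 hx⟩
  · exact contMDiff_iff_contDiff.mp f.contMDiff
  · exact IsCompact.of_isClosed_subset hC.cthickening (isClosed_tsupport _) htsupp

/-- **Sheaf step (locality of the support of a functional).**  If a functional `G` on `𝓢(X, ℂ)` vanishes on the
compactly supported test functions supported in some neighbourhood of each point of a compact set `K`, then it
vanishes on the compactly supported test functions supported in some open `W ⊇ K`.  (Hörmander, *ALPDO I*,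
Thm 2.2.1; proved by `IsCompact.induction_on`, the binary union step splitting `H = χ H + (1 - χ) H` with a smooth
cutoff `χ` equal to `1` near the part of `tsupport H` not covered by the second open set.) -/
theorem exists_isOpen_forall_eq_zero_of_locally (G : 𝓢(X, ℂ) →L[ℂ] ℂ) {K : Set X} (hK : IsCompact K)
    (hloc : ∀ x ∈ K, ∃ V ∈ 𝓝 x, ∀ H : 𝓢(X, ℂ), HasCompactSupport (H : X → ℂ) →
      tsupport (H : X → ℂ) ⊆ V → G H = 0) :
    ∃ W : Set X, IsOpen W ∧ K ⊆ W ∧ ∀ H : 𝓢(X, ℂ), HasCompactSupport (H : X → ℂ) →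
      tsupport (H : X → ℂ) ⊆ W → G H = 0 := by
  refine hK.induction_on (p := fun s => ∃ W : Set X, IsOpen W ∧ s ⊆ W ∧ ∀ H : 𝓢(X, ℂ),
    HasCompactSupport (H : X → ℂ) → tsupport (H : X → ℂ) ⊆ W → G H = 0) ?_ ?_ ?_ ?_
  · refine ⟨∅, isOpen_empty, Subset.rfl, fun H _ hH => ?_⟩
    have : H = 0 := by
      ext x
      exact image_eq_zero_of_notMem_tsupport fun hx => hH hx
    rw [this, map_zero]
  · rintro s t hst ⟨W, hW, htW, h⟩
    exact ⟨W, hW, hst.trans htW, h⟩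
  · rintro s t ⟨W₁, hW₁, hsW₁, h₁⟩ ⟨W₂, hW₂, htW₂, h₂⟩
    refine ⟨W₁ ∪ W₂, hW₁.union hW₂, union_subset_union hsW₁ htW₂, fun H hHc hHW => ?_⟩
    -- split `H` with a cutoff near the compact part of its support not covered by `W₂`
    have hL : IsCompact (tsupport (H : X → ℂ) \ W₂) := hHc.diff hW₂
    have hLW₁ : tsupport (H : X → ℂ) \ W₂ ⊆ W₁ := fun x hx =>
      (hHW hx.1).resolve_right hx.2
    obtain ⟨χ, hχ, hχc, hχW₁, hχ01, U, hU, hLU, hU1⟩ :=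
      exists_contDiff_one_nhds_of_isCompact_subset hL hW₁ hLW₁
    have hχg : χ.HasTemperateGrowth := hχc.hasTemperateGrowth hχ
    set H₁ : 𝓢(X, ℂ) := SchwartzMap.smulLeftCLM ℂ χ H with hH₁def
    have hH₁ : ∀ x, H₁ x = χ x • H x := fun x => SchwartzMap.smulLeftCLM_apply_apply hχg H x
    set H₂ : 𝓢(X, ℂ) := H - H₁ with hH₂def
    have hH₂ : ∀ x, H₂ x = (1 - χ x) • H x := fun x => by
      rw [hH₂def, sub_apply, hH₁, sub_smul, one_smul]
    have hsupp₁ : Function.support (H₁ : X → ℂ) ⊆ Function.support (H : X → ℂ) := by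
      intro x hx
      simp only [Function.mem_support, hH₁] at hx ⊢
      exact fun h0 => hx (by rw [h0, smul_zero])
    have hsupp₂ : Function.support (H₂ : X → ℂ) ⊆ Function.support (H : X → ℂ) := by
      intro x hx
      simp only [Function.mem_support, hH₂] at hx ⊢
      exact fun h0 => hx (by rw [h0, smul_zero])
    have hG₁ : G H₁ = 0 := by
      refine h₁ H₁ (hHc.mono hsupp₁) ?_
      exact ((SchwartzMap.tsupport_smulLeftCLM_subset χ H).trans inter_subset_right).trans hχW₁
    have hG₂ : G H₂ = 0 := by
      refine h₂ H₂ (hHc.mono hsupp₂) fun x hx => ?_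
      have hxK : x ∈ tsupport (H : X → ℂ) := closure_mono hsupp₂ hx
      by_contra hxW₂
      have hxU : x ∈ U := hLU ⟨hxK, hxW₂⟩
      refine (notMem_tsupport_iff_eventuallyEq.mpr ?_) hx
      filter_upwards [hU.mem_nhds hxU] with y hy
      simp only [hH₂, hU1 y hy, sub_self, zero_smul, Pi.zero_apply]
    calc G H = G (H₁ + H₂) := by rw [hH₂def, add_sub_cancel]
      _ = 0 := by rw [map_add, hG₁, hG₂, add_zero]
  · intro x hx
    obtain ⟨V, hV, hGV⟩ := hloc x hx
    exact ⟨interior V, mem_nhdsWithin_of_mem_nhds (interior_mem_nhds.mpr hV), interior V, isOpen_interior,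
      Subset.rfl, fun H hHc hHV => hGV H hHc (hHV.trans interior_subset)⟩

end General

/-- **Null-set closure** (helper of `stub_locality`, step T6).  Let `G` be a continuous linear functional on the
Schwartz `n`-point functions of `ℝ⁴` which (i) near every configuration outside a closed Lebesgue-null set `N`
vanishes on compactly supported test functions (`hloc`), and (ii) for every `δ > 0` is bounded by a multiple of the
`L¹` norm on compactly supported test functions supported in `Separated n δ` (`hB`, bounded densities off the
diagonal).  Then `G F = 0` for every compactly supported `F` with `tsupport F ⊆ Separated n δ`.  Proof: split
`F = χF + (1 - χ)F` with a smooth cutoff `χ ∈ [0,1]` equal to `1` near the compact null set `N ∩ tsupport F` and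
supported in an open set of volume `< η` (outer regularity of Lebesgue measure); the sheaf step
`exists_isOpen_forall_eq_zero_of_locally` kills the second piece, the density bound gives
`‖G (χF)‖ ≤ B · sup ‖F‖ · η`, and `η → 0`. -/
theorem eq_zero_of_null_exceptional {n : ℕ} (G : 𝓢((Fin n → EuclideanSpace ℝ (Fin 4)), ℂ) →L[ℂ] ℂ) (N : Set (Fin n → EuclideanSpace ℝ (Fin 4))) (hN : IsClosed N) (hN0 : MeasureTheory.volume N = 0) (hB : ∀ δ : ℝ, 0 < δ → ∃ B : ℝ, ∀ F : 𝓢((Fin n → EuclideanSpace ℝ (Fin 4)), ℂ), HasCompactSupport (F : (Fin n → EuclideanSpace ℝ (Fin 4)) → ℂ) → tsupport (F : (Fin n → EuclideanSpace ℝ (Fin 4)) → ℂ) ⊆ Separated n δ → ‖G F‖ ≤ B * ∫ x, ‖F x‖) (hloc : ∀ x : Fin n → EuclideanSpace ℝ (Fin 4), x ∉ N → ∃ V ∈ 𝓝 x, ∀ F : 𝓢((Fin n → EuclideanSpace ℝ (Fin 4)), ℂ), HasCompactSupport (F : (Fin n → EuclideanSpace ℝ (Fin 4)) → ℂ) → tsupport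 (F : (Fin n → EuclideanSpace ℝ (Fin 4)) → ℂ) ⊆ V → G F = 0) (δ : ℝ) (hδ : 0 < δ) (F : 𝓢((Fin n → EuclideanSpace ℝ (Fin 4)), ℂ)) (hFc : HasCompactSupport (F : (Fin n → EuclideanSpace ℝ (Fin 4)) → ℂ)) (hFδ : tsupport (F : (Fin n → EuclideanSpace ℝ (Fin 4)) → ℂ) ⊆ Separated n δ) : G F = 0 := by
  obtain ⟨B, hB⟩ := hB δ hδ
  obtain ⟨M, hM⟩ := F.continuous.bounded_above_of_compact_support hFc
  have hM0 : 0 ≤ M := (norm_nonneg _).trans (hM 0)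
  set K : Set (Fin n → EuclideanSpace ℝ (Fin 4)) := tsupport (F : (Fin n → EuclideanSpace ℝ (Fin 4)) → ℂ)
  have hK : IsCompact K := hFc
  -- the key estimate: `‖G F‖ ≤ B⁺ M η` for every `η > 0`
  have key : ∀ η : ℝ, 0 < η → ‖G F‖ ≤ max B 0 * M * η := by
    intro η hη
    haveI : (volume : Measure (Fin n → EuclideanSpace ℝ (Fin 4))).Regular :=
      Measure.Regular.of_sigmaCompactSpace_of_isLocallyFiniteMeasure _
    have hC : IsCompact (K ∩ N) := hK.inter_right hN
    have hC0 : volume (K ∩ N) = 0 := measure_mono_null inter_subset_right hN0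
    obtain ⟨O, hCO, hO, hOη⟩ := (K ∩ N).exists_isOpen_lt_of_lt (ENNReal.ofReal η)
      (by rw [hC0]; exact ENNReal.ofReal_pos.mpr hη)
    obtain ⟨χ, hχ, hχc, hχO, hχ01, U, hU, hCU, hU1⟩ := exists_contDiff_one_nhds_of_isCompact_subset hC hO hCO
    have hχg : χ.HasTemperateGrowth := hχc.hasTemperateGrowth hχ
    set F₁ : 𝓢((Fin n → EuclideanSpace ℝ (Fin 4)), ℂ) := SchwartzMap.smulLeftCLM ℂ χ F with hF₁def
    have hF₁ : ∀ x, F₁ x = χ x • F x := fun x => SchwartzMap.smulLeftCLM_apply_apply hχg F x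
    set F₂ : 𝓢((Fin n → EuclideanSpace ℝ (Fin 4)), ℂ) := F - F₁ with hF₂def
    have hF₂ : ∀ x, F₂ x = (1 - χ x) • F x := fun x => by
      rw [hF₂def, sub_apply, hF₁, sub_smul, one_smul]
    have hsupp₁ :
        Function.support (F₁ : (Fin n → EuclideanSpace ℝ (Fin 4)) → ℂ) ⊆ Function.support F := by
      intro x hx
      simp only [Function.mem_support, hF₁] at hx ⊢
      exact fun h0 => hx (by rw [h0, smul_zero])
    have hsupp₂ :
        Function.support (F₂ : (Fin n → EuclideanSpace ℝ (Fin 4)) → ℂ) ⊆ Function.support F := by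
      intro x hx
      simp only [Function.mem_support, hF₂] at hx ⊢
      exact fun h0 => hx (by rw [h0, smul_zero])
    -- `F₂` is supported away from `N`: the sheaf step kills it
    have hG₂ : G F₂ = 0 := by
      have hK₂ : IsCompact (tsupport (F₂ : (Fin n → EuclideanSpace ℝ (Fin 4)) → ℂ)) := hFc.mono hsupp₂
      have hK₂N : ∀ x ∈ tsupport (F₂ : (Fin n → EuclideanSpace ℝ (Fin 4)) → ℂ), x ∉ N := by
        intro x hx hxN
        have hxK : x ∈ K := closure_mono hsupp₂ hx
        have hxU : x ∈ U := hCU ⟨hxK, hxN⟩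
        refine (notMem_tsupport_iff_eventuallyEq.mpr ?_) hx
        filter_upwards [hU.mem_nhds hxU] with y hy
        simp only [hF₂, hU1 y hy, sub_self, zero_smul, Pi.zero_apply]
      obtain ⟨W, -, hKW, hW⟩ := exists_isOpen_forall_eq_zero_of_locally G hK₂
        fun x hx => hloc x (hK₂N x hx)
      exact hW F₂ (hFc.mono hsupp₂) hKW
    -- `F₁` is small in `L¹`: the density bound controls it
    have hG₁ : ‖G F₁‖ ≤ max B 0 * M * η := by
      have hF₁c : HasCompactSupport (F₁ : (Fin n → EuclideanSpace ℝ (Fin 4)) → ℂ) := hFc.mono hsupp₁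
      have hF₁δ : tsupport (F₁ : (Fin n → EuclideanSpace ℝ (Fin 4)) → ℂ) ⊆ Separated n δ :=
        (closure_mono hsupp₁).trans hFδ
      have hint : ∫ x, ‖F₁ x‖ ≤ M * η := by
        have hzero : ∀ x, x ∉ O → ‖F₁ x‖ = 0 := by
          intro x hx
          have : χ x = 0 := image_eq_zero_of_notMem_tsupport fun h => hx (hχO h)
          rw [hF₁, this, zero_smul, norm_zero]
        rw [← setIntegral_eq_integral_of_forall_compl_eq_zero hzero]
        have hle : ∀ x ∈ O, ‖‖F₁ x‖‖ ≤ M := by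
          intro x _
          rw [norm_norm, hF₁, norm_smul]
          calc ‖χ x‖ * ‖F x‖ ≤ 1 * M := by
                refine mul_le_mul ?_ (hM x) (norm_nonneg _) zero_le_one
                rw [Real.norm_of_nonneg (hχ01 x).1]
                exact (hχ01 x).2
            _ = M := one_mul M
        calc ∫ x in O, ‖F₁ x‖ ≤ ‖∫ x in O, ‖F₁ x‖‖ := Real.le_norm_self _
          _ ≤ M * volume.real O := norm_setIntegral_le_of_norm_le_const (hOη.trans ENNReal.ofReal_lt_top) hle
          _ ≤ M * η := by
            refine mul_le_mul_of_nonneg_left ?_ hM0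
            exact ENNReal.toReal_le_of_le_ofReal hη.le hOη.le
      calc ‖G F₁‖ ≤ B * ∫ x, ‖F₁ x‖ := hB F₁ hF₁c hF₁δ
        _ ≤ max B 0 * ∫ x, ‖F₁ x‖ :=
          mul_le_mul_of_nonneg_right (le_max_left B 0) (integral_nonneg fun x => norm_nonneg _)
        _ ≤ max B 0 * (M * η) := mul_le_mul_of_nonneg_left hint (le_max_right B 0)
        _ = max B 0 * M * η := (mul_assoc _ _ _).symm
    calc ‖G F‖ = ‖G (F₁ + F₂)‖ := by rw [hF₂def, add_sub_cancel]
      _ = ‖G F₁‖ := by rw [map_add, hG₂, add_zero]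
      _ ≤ max B 0 * M * η := hG₁
  -- let `η → 0`
  have h0 : ‖G F‖ ≤ 0 := by
    refine le_of_forall_pos_le_add fun ε hε => ?_
    have hpos : 0 < max B 0 * M + 1 := by positivity
    calc ‖G F‖ ≤ max B 0 * M * (ε / (max B 0 * M + 1)) := key _ (div_pos hε hpos)
      _ ≤ ε := by
        rw [mul_div_assoc', div_le_iff₀ hpos]
        nlinarith [mul_nonneg (le_max_right B 0) hM0]
      _ = 0 + ε := (zero_add ε).symm
  exact norm_le_zero_iff.mp h0

end Summit.QuantumFields.YangMills.Cruxes.OSLegsAtWeakCouplingC.Sketch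

end
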